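import Summits.Ventures.QEC.Census.FoldLift
import HarnessLib

/-!
# Fold enumeration — the zero node, translated doubles, and the step-frugal twins

Continuation of `Census/FoldLift.lean`: `Geo.aPart_transW_double`, `Geo.goodFib_zero_of_zeroCheck`, `popcF_eq`,
`Geo.zeroCheckS_eq`, `Geo.goodFib_of_liftCheckS`.
-/

namespace Summit.Ventures.QEC.Census.Fold

open Summit.Ventures.QEC.Census

namespace Geo

variable {G : Geo}

/-- Translating a double translates the doubled small word: the section part of a translated double. -/
theorem aPart_transW_double (hS : G.Shape) (hG : G.OK) {c : ℕ} (hc : c < 2 ^ G.ns) (da db : ℕ) :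
    G.aPart (transW G.l G.m da db (G.double c)) = transW G.ls G.ms da db c := by
  have add_sub_mod_self : ∀ {l : ℕ}, 0 < l → ∀ da : ℕ, (da + (l - da % l)) % l = 0 := by
    intro l hl da
    have h2 : da + (l - da % l) = l * (da / l + 1) := by
      have := Nat.div_add_mod da l; have := Nat.mod_lt da hl
      rw [Nat.mul_add, Nat.mul_one]; omega
    rw [h2, Nat.mul_mod_right]
  have hl := hS.l_pos; have hm := hS.m_pos; have hls := hS.ls_pos; have hms := hS.ms_pos
  have hdlt : G.double c < 2 ^ G.n := by
    rw [double]; exact Nat.xor_lt_two_pow (lin_lt_two_pow _ _ _ (fun j hj => Nat.pow_lt_pow_right (by norm_num) (hG.emb_lt j hj)) c)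
      (lin_lt_two_pow _ _ _ (fun j hj => Nat.pow_lt_pow_right (by norm_num) (hG.partner_lt _ (hG.emb_lt j hj))) c)
  set w := transW G.l G.m da db (G.double c) with hw
  have hwlt : w < 2 ^ G.n := by rw [hw, Geo.n]; exact transW_lt hl hm da db _
  -- bits of double c: at emb j and partner (emb j) both equal c_j
  have hdb : ∀ j, j < G.ns → (G.double c).testBit (G.emb j) = c.testBit j ∧ (G.double c).testBit (G.partner (G.emb j)) = c.testBit j := by
    intro j hj
    rw [double, Nat.testBit_xor, Nat.testBit_xor, testBit_embW_emb hG c hj, testBit_parW_emb hG c hj, Bool.xor_false]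
    refine ⟨rfl, ?_⟩
    have h1 : (G.embW c).testBit (G.partner (G.emb j)) = false := by
      rw [Bool.eq_false_iff]; intro h
      obtain ⟨j', hj', -, he⟩ := (testBit_embW hG).1 h
      have := hG.fold_partner _ (hG.emb_lt j hj)
      rw [← he, hG.fold_emb j hj, hG.fold_emb j' hj'] at this
      subst this; exact hG.partner_emb_ne _ hj he.symm
    have h2 : (G.parW c).testBit (G.partner (G.emb j)) = c.testBit j := by
      rcases hb : c.testBit j with _ | _
      · rw [Bool.eq_false_iff]; intro h
        obtain ⟨j', hj', hb', he⟩ := (testBit_parW hG).1 h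
        have := partner_emb_inj hG hj' hj he; subst this
        rw [hb] at hb'; exact Bool.false_ne_true hb'
      · exact (testBit_parW hG).2 ⟨j, hj, hb, rfl⟩
    rw [h1, h2, Bool.false_xor]
  apply Nat.eq_of_testBit_eq; intro j
  by_cases hj : j < G.ns
  · rw [← testBit_emb_eq hG hwlt hj]
    -- emb j = transIdx (da,db) J₀ for J₀ := the inverse translate of emb j; fold J₀ = inverse small translate of j
    set J₀ := transIdx G.l G.m (G.l - da % G.l) (G.m - db % G.m) (G.emb j) with hJ₀
    have hJ₀lt : J₀ < G.n := by rw [hJ₀, Geo.n]; exact transIdx_lt hl hm _ _ (hG.emb_lt j hj)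
    have hembj : G.emb j = transIdx G.l G.m da db J₀ := by
      rw [hJ₀, transIdx_comp hl hm, ← transIdx_mod, add_sub_mod_self hl, add_sub_mod_self hm,
        transIdx_zero hl hm (hG.emb_lt j hj)]
    rw [hembj, hw, testBit_transW hl hm da db _ hJ₀lt (by rw [← Geo.n]; exact hdlt)]
    -- J₀ is emb j₀ or partner (emb j₀) with j₀ = fold J₀ = inverse small translate of j
    set j₀ := G.foldIdx J₀ with hj₀
    have hj₀lt : j₀ < G.ns := hG.foldIdx_lt _ hJ₀lt
    have hjeq : j = transIdx G.ls G.ms da db j₀ := by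
      have := foldIdx_transIdx hS da db hJ₀lt
      rw [← hembj, hG.fold_emb j hj] at this
      exact this
    have hcj : c.testBit j₀ = (transW G.ls G.ms da db c).testBit j := by
      rw [hjeq, testBit_transW hls hms da db c hj₀lt (by rw [← ns_eq]; exact hc)]
    rcases hG.cover J₀ hJ₀lt with hcase | hcase
    · rw [← hcase, (hdb j₀ hj₀lt).1, hcj]
    · rw [← hcase, (hdb j₀ hj₀lt).2, hcj]
  · rw [not_lt] at hj
    rw [Nat.testBit_lt_two_pow (lt_of_lt_of_le (aPart_lt hG w) (Nat.pow_le_pow_right (by norm_num) hj)),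
      Nat.testBit_lt_two_pow (lt_of_lt_of_le (transW_lt hls hms da db c) (by rw [← ns_eq]; exact Nat.pow_le_pow_right (by norm_num) hj))]

/-- **ZERO NODE.**  With `Cands` complete (up to translation) for the small kernel words of weight `≤ B`,
`2B ≥ W`... precisely `W ≤ 2B + 1`, a passing `zeroCheck` establishes the fibre property of the zero word:
every big kernel word of weight `≤ W` with trivial fold is a translate of the double of a candidate. -/
theorem goodFib_zero_of_zeroCheck (hS : G.Shape) (hG : G.OK) {Cb Cs : TCode} (hCF : G.ColFold Cb Cs) (heqg : Cb.ColEquiv G.gen.1 G.gen.2)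
    (_heq : ∀ da db, Cb.ColEquiv da db) (hCb : Cb.l = G.l ∧ Cb.m = G.m) (hcol : ∀ J, J < Cb.n → Cb.col J < 2 ^ (Cb.l * Cb.m))
    {W B : ℕ} (hB : W ≤ 2 * B + 1) {Cands : List ℕ}
    (hCands : ∀ c, c < 2 ^ G.ns → Cs.ker G.ns c → popc G.ns c ≤ B → Matched G.ls G.ms Cands c)
    {k : List ℕ → Bool} {Q : ℕ → Prop} (hQ : ∀ da db u, Q (transW G.l G.m da db u) → Q u)
    (hk : ∀ S', (∀ J ∈ S', J < G.n) → S'.length = popc G.n (maskOf S') → k S' = true → Q (maskOf S'))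
    (h : zeroCheck G W Cands k = true) : GoodFib G Cb W Q 0 := by
  intro u hu hker hwt hfold
  have hl := hS.l_pos; have hm := hS.m_pos; have hls := hS.ls_pos; have hms := hS.ms_pos
  -- u = double c with c ∈ ker_s, 2|c| = |u|
  set c := G.aPart u with hc
  have hud : u = G.double c := eq_double_of_foldW_eq_zero hG hu hfold
  have hclt : c < 2 ^ G.ns := aPart_lt hG _
  have hcker : Cs.ker G.ns c := ker_of_double_ker hS hG hCF heqg hCb hcol hclt (hud ▸ hker)
  have hcw : popc G.ns c ≤ B := by
    have h1 : popc G.n u = 2 * popc G.ns c := by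
      rw [hud, double, popc_xor_of_and_eq_zero (embW_and_parW hG _ _), popc_embW hG, popc_parW hG]; ring
    omega
  obtain ⟨c₀, hc₀, da, db, htr⟩ := hCands c hclt hcker hcw
  -- c₀ = translate of c; u' := translate of u is double c₀ up to ... we show Q (double c₀) ⇒ Q u via translation
  have hc₀lt : c₀ < 2 ^ G.ns := by rw [← htr, ns_eq]; exact transW_lt hls hms da db c
  have hc₀c : c = transW G.ls G.ms (G.ls - da % G.ls) (G.ms - db % G.ms) c₀ := by
    rw [← htr, transW_inv hls hms (by rw [← ns_eq]; exact hclt)]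
  -- the translated big word
  set u' := transW G.l G.m da db u with hu'
  have hu'd : u' = G.double c₀ := by
    have hu'lt : u' < 2 ^ G.n := by rw [hu', Geo.n]; exact transW_lt hl hm da db u
    have hf' : G.foldW u' = 0 := by rw [hu', foldW_transW hS hG, hfold, transW, lin_zero]
    rw [eq_double_of_foldW_eq_zero hG hu'lt hf', hu', hud, aPart_transW_double hS hG hclt, htr]
  -- the check covers c₀
  rw [zeroCheck, List.all_eq_true] at h
  have h1 := h c₀ hc₀
  simp only [Bool.or_eq_true, Bool.not_eq_true', decide_eq_false_iff_not] at h1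
  have hwt' : popc G.n (G.double c₀) ≤ W := by rw [← hu'd, hu', Geo.n, popc_transW hl hm]; exact hwt
  rcases h1 with h1 | h1
  · exact absurd hwt' h1
  · have hdlt : G.double c₀ < 2 ^ G.n := by rw [← hu'd, hu', Geo.n]; exact transW_lt hl hm da db u
    have := hk _ (fun J hJ => lt_of_mem_bitsOf hJ) (by rw [maskOf_bitsOf_zero _ _ hdlt, length_bitsOf]) h1
    rw [maskOf_bitsOf_zero _ _ hdlt, ← hu'd, hu'] at this
    exact hQ da db u this

end Geo

end Summit.Ventures.QEC.Census.Fold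

namespace Summit.Ventures.QEC.Census.Fold

open Summit.Ventures.QEC.Census

/-! ## The step-frugal twins agree with the originals -/

/-- `pt8`: pt8 (auxiliary lemma of the fold-certificate soundness chain). -/
theorem pt8 : ∀ x, x < 256 → tab PT8 4 x = popc 8 x := by decide +kernel

/-- `popc8_eq`: popc8 eq (auxiliary lemma of the fold-certificate soundness chain). -/
theorem popc8_eq (k u : ℕ) : popc8 k u = popc (8 * k) u := by
  induction k generalizing u with
  | zero => rfl
  | succ k ih =>
    rw [popc8, ih, pt8 _ (Nat.mod_lt _ (by decide)), show 8 * (k + 1) = 8 + 8 * k by ring, popc_split]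
    rfl

/-- `popcF_eq`: popcF eq (auxiliary lemma of the fold-certificate soundness chain). -/
theorem popcF_eq (n u : ℕ) : popcF n u = popc n u := by
  rw [popcF, popc8_eq, ← popc_split]
  congr 1
  exact Nat.div_add_mod n 8

namespace Geo

variable {G : Geo}

/-- `doubleL_eq`: doubleL eq (auxiliary lemma of the fold-certificate soundness chain). -/
theorem doubleL_eq {S : List ℕ} (hS : ∀ j ∈ S, j < G.ns) : G.doubleL S = G.double (maskOf S) := by
  rw [doubleL, double, embW, parW, ← xorIdx_eq_lin _ _ _ hS, ← xorIdx_eq_lin _ _ _ hS, maskOf, maskOf, xorIdx_map,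
    xorIdx_map]
  rfl

/-- `doubleL_bitsOf`: doubleL bitsOf (auxiliary lemma of the fold-certificate soundness chain). -/
theorem doubleL_bitsOf (c : ℕ) : G.doubleL (bitsOf G.ns 0 c) = G.double c := by
  rw [doubleL_eq (fun j hj => lt_of_mem_bitsOf hj), maskOf_bitsOf, Nat.pow_zero, Nat.one_mul, double, double,
    embW, embW, parW, parW, lin_mod, lin_mod]

/-- `zeroCheckS_eq`: zeroCheckS eq (auxiliary lemma of the fold-certificate soundness chain). -/
theorem zeroCheckS_eq (W : ℕ) (Cands : List ℕ) (k : List ℕ → Bool) : zeroCheckS G W Cands k = zeroCheck G W Cands k := by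
  unfold zeroCheckS zeroCheck
  simp only [doubleL_bitsOf, popcF_eq]

end Geo

namespace Geo

variable {G : Geo}

/-- **LIFT (translated-lift form).** -/
theorem goodFib_of_liftCheckS (hS : G.Shape) (hG : G.OK) {Cb Cs : TCode} (hCF : G.ColFold Cb Cs) (heq : Cb.ColEquiv G.gen.1 G.gen.2)
    (hCb : Cb.l = G.l ∧ Cb.m = G.m) (hcol : ∀ J, J < Cb.n → Cb.col J < 2 ^ (Cb.l * Cb.m))
    {W B st v : ℕ} (hst : st < 2 ^ G.n) (hstker : Cb.ker G.n st) (hstfold : G.foldW st = v) (hB : W + popc G.n st ≤ 2 * B + 1)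
    {STS : List ℕ} (hSTS : ∀ da, da < G.ls → ∀ db, db < G.ms → transW G.l G.m da db st ∈ STS)
    {Cands : List ℕ} (hCands : ∀ c, c < 2 ^ G.ns → Cs.ker G.ns c → popc G.ns c ≤ B → Matched G.ls G.ms Cands c)
    {k : List ℕ → Bool} {Q : ℕ → Prop} (hQ : ∀ da db u, Q (transW G.l G.m da db u) → Q u)
    (hk : ∀ S', (∀ J ∈ S', J < G.n) → S'.length = popc G.n (maskOf S') → k S' = true → Q (maskOf S'))
    (h : liftCheckS G W STS Cands k = true) : GoodFib G Cb W Q v := by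
  intro u hu hker hwt hfold
  have hl := hS.l_pos; have hm := hS.m_pos; have hls := hS.ls_pos; have hms := hS.ms_pos
  -- w := u ⊕ st has trivial fold, so w = double c
  have hwlt : u ^^^ st < 2 ^ G.n := Nat.xor_lt_two_pow hu hst
  have hwker : Cb.ker G.n (u ^^^ st) := by unfold TCode.ker at *; rw [lin_xor, hker, hstker, Nat.xor_zero]
  have hwfold : G.foldW (u ^^^ st) = 0 := by rw [foldW_xor, hfold, hstfold, Nat.xor_self]
  set c := G.aPart (u ^^^ st) with hc
  have hwd : u ^^^ st = G.double c := eq_double_of_foldW_eq_zero hG hwlt hwfold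
  have hclt : c < 2 ^ G.ns := aPart_lt hG _
  have hcker : Cs.ker G.ns c := ker_of_double_ker hS hG hCF heq hCb hcol hclt (hwd ▸ hwker)
  have hcw : popc G.ns c ≤ B := by
    have h1 : popc G.n (u ^^^ st) = 2 * popc G.ns c := by
      rw [hwd, double, popc_xor_of_and_eq_zero (embW_and_parW hG _ _), popc_embW hG, popc_parW hG]; ring
    have h2 := popc_xor_add G.n u st
    omega
  obtain ⟨c₀, hc₀, da, db, htr⟩ := hCands c hclt hcker hcw
  -- reduce the translation into the window
  set da' := da % G.ls with hda'
  set db' := db % G.ms with hdb'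
  have htr' : transW G.ls G.ms da' db' c = c₀ := by rw [hda', hdb', transW_mod]; exact htr
  -- translate everything by (da', db')
  set u' := transW G.l G.m da' db' u with hu'
  set st' := transW G.l G.m da' db' st with hst'
  have hu'lt : u' < 2 ^ G.n := by rw [hu', Geo.n]; exact transW_lt hl hm _ _ u
  have hw' : u' ^^^ st' = G.double c₀ := by
    have hw'lt : u' ^^^ st' < 2 ^ G.n := by
      rw [hu', hst', ← transW_xor, Geo.n]; exact transW_lt hl hm _ _ _
    have hf' : G.foldW (u' ^^^ st') = 0 := by
      rw [hu', hst', ← transW_xor, foldW_transW hS hG, hwfold, transW, lin_zero]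
    rw [eq_double_of_foldW_eq_zero hG hw'lt hf', hu', hst', ← transW_xor, hwd,
      aPart_transW_double hS hG hclt, htr']
  have hu'eq : u' = st' ^^^ G.double c₀ := by
    rw [← hw', ← Nat.xor_assoc, Nat.xor_comm st' u', Nat.xor_assoc, Nat.xor_self, Nat.xor_zero]
  -- the check covered (c₀, st')
  rw [liftCheckS, List.all_eq_true] at h
  have h1 := h c₀ hc₀
  simp only at h1
  rw [List.all_eq_true] at h1
  have h2 := h1 st' (hSTS da' (Nat.mod_lt _ hls) db' (Nat.mod_lt _ hms))
  simp only [Bool.or_eq_true, Bool.not_eq_true', decide_eq_false_iff_not, doubleL_bitsOf, popcF_eq] at h2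
  have hwt' : popc G.n (st' ^^^ G.double c₀) ≤ W := by rw [← hu'eq, hu', Geo.n, popc_transW hl hm]; exact hwt
  rcases h2 with h2 | h2
  · exact absurd hwt' h2
  · have hlt2 : st' ^^^ G.double c₀ < 2 ^ G.n := hu'eq ▸ hu'lt
    have := hk _ (fun J hJ => lt_of_mem_bitsOf hJ) (by rw [maskOf_bitsOf_zero _ _ hlt2, length_bitsOf]) h2
    rw [maskOf_bitsOf_zero _ _ hlt2, ← hu'eq, hu'] at this
    exact hQ da' db' u this

end Geo

end Summit.Ventures.QEC.Census.Fold
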